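import Summits.QuantumFields.YangMills.Theorems.BalabanUVNodesN07PointFeasibilityOneLevel
import Literature.MathematicalPhysics.QuantumFieldTheory.Balaban1983to89.B6ProjR212TorusBridge
import Literature.MathematicalPhysics.QuantumFieldTheory.Balaban1983to89.B15DeterminingSets
import Literature.MathematicalPhysics.QuantumFieldTheory.Balaban1983to89.T4UndoubledRP
import HarnessLib

/-!
# DAG node N07 [B11], road R0′ — LEMMA (P) ONE LEVEL read on the RECORD'S OWN CARRIER `Site P 0` ∕ V1 (`ScalarSpace P`, `RE D c`, `lapE c`, `dE c`):
# «`f` constant on the centres `embIter j y` ∧ `RE D c (lapE c f) = 0` for a one-level `D` ⇒ `f` constant, `dE c f = 0`» — the dictionary corollary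
# of `N07PointFeasibilityOneLevel.pointFeasibility_oneLevel` through r03∕p16∕p21's transports (file 4 of the lineage)

Cell `pub-ymgap` (HUMAN RULINGS D-0062 ∕ D-0149 ∕ D-0154), width seat `pub-ymgap-dag-n07-w5` g0′, 2026-08-28.  `--kind proof --supports <K1 key> --as helper`
(count-neutral; CLAIM-2 cell bus 09:22Z — the «(β) dictionary corollary» that dag-n07-w7 g3 ∕ dag-n07-e g20 left to this base as its 4∕4).

THE PRINT.  [B5] = T. Bałaban, CMP **95** (1984) 17–40 `[Balaban1984PropagatorsI]`, (1.17)–(1.20) p. 20 (the tower `T^{(0)} ≃ Tor (fine (L^j) M)`, blocks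
`B^j(y) = {L^j·y + r}`), p. 25 («R … an orthogonal projection on the linear subspace ΔN(Q′_k)»); [B6] = CMP **96** (1984) 223–250 `[Balaban1984PropagatorsII]`,
(2.10)–(2.12) p. 225 (`R` = V1's `RE D c`), (2.22) p. 226; [I] = CMP **109** (1987) 249–301 `[Balaban1987RG1]`, (0.1) p. 251 («Each lattice determines a lattice of
centers of these cubes» — `Setup.emb`, `B15DeterminingSets.embIter`: label `y ↦ L^j·y + (L^j − 1)∕2`), (0.4) p. 253.

WHAT THIS FILE DOES (pure transport; nothing new asserted).
* §1 `val_embIter` (`(embIter j y)_μ = y_μ·L^j + (L^j − 1)∕2`, standing range), `half_pow_lt` (oddness `2·((L^j−1)∕2)+1 = L^j` is gen16's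
  `T4UndoubledRP.two_mul_half_pow_add_one`, imported), ★ `embIter_eq_blockSiteK` — the record's
  centre `embIter j y` IS p16's block point `blockSiteK j y c₀` at the middle offset `c₀ = (L^j − 1)∕2`, hence `EK hj (embIter j y) = bpt (L^j) (Mk P j) y c₀`
  (`EK_embIter`).
* §2 `trS_cplxS_tS_apply` (values of the transported function), `trS_cplxS_tS_zero`, `trS_cplxS_smul`, ★ `RT_LapS_transport_eq_zero`
  (`RE D c (lapE c f) = 0 ⇒ RT (L^j) (Mk P j) *ᵥ (LapS *ᵥ f̃) = 0` by r03's `RE_bridge` + `tS_laplace` + p21's `LapS_towerE`; `hD` = «`N(Q′_D) = N(Q′_j)`»).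
* §3 ★★★ `eq_const_of_centres_of_RE_lapE_eq_zero` (every `P : Params`, `j ≤ m + K`, every one-level `D` in the sense of `hD`, `c ≠ 0`: centres-constant ∧
  `RE D c (lapE c f) = 0` ⇒ `∀ x x′, f x = f x′`), ★★★ `dE_eq_zero_of_centres_of_RE_lapE_eq_zero` (⇒ `dE c f = 0` — the conclusion of the `hker` letter of
  `N07FlatHFeasibility.exists_admissible_grad_of_flatKernel` with `E` = evaluation at the centres), and the instances at p22's one-level member `twoScale j hj ∅`
  (`…_twoScale_empty`).

HONEST FRAMING (binding).  Count-neutral helper; transport∕dictionary bookkeeping over landed theorems BY NAME (r03 `B6ProjR212TorusBridge.RE_bridge`∕`tS_laplace`,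
p16 `B5Eq117TorusCarriers.EK`∕`tS`∕`EK_blockSiteK`, p21 `B5TowerOneStroke.trS`∕`towerE` + `B5HkOpLandauMin.LapS_towerE`, this seat's p620292); ONE averaging
level only (all `Ω_i = T_η`: `N(Q′_D) = N(Q′_j)`), the MULTI-LEVEL `(P)_D` that the record's heart family `Node00.cubeDomains` needs stays OPEN (dag-n07-w7 g3: d = 1 every
nesting typed; d ≥ 2 open); under road (a) of the K0 lineage `(P)` is not consumed; nothing of [B11]∕[B6]∕[3]'s analysis asserted; `hker` at the record ∕ stub 1 ∕ K0⁷ ∕ K1⁸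
NOT closed; N07 NOT discharged; counts unmoved; no summit statement is proved by this seat — R4 closes the conditional finite-𝕋⁴ rung `BalabanLadder.UV` only; nothing
continuum ∕ ℝ⁴ ∕ OS ∕ mass gap ∕ Clay.  No `sorry`, no `def`, no `instance`, no `notation`.
-/

noncomputable section

open scoped BigOperators Matrix ComplexConjugate

namespace Summit.QuantumFields.YangMills.BalabanUVNodes.N07PointFeasibilityOneLevelV1

open Literature.MathematicalPhysics.QuantumFieldTheory.Balaban1983to89
open LatticeFieldCalculus B6SectADomainsV1 B6SectAOperatorsV1 B6SectCTwoScaleV1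
open B5SectBStatements (Scl cplxS towerM)
open B5TowerOneStroke (towerE trS trS_apply trS_apply')
open B5Eq117TorusCarriers (Mk eK EK tS tS_apply blockSiteK val_blockSiteK EK_blockSiteK)
open B6ProjR212TorusBridge (RE_bridge tS_laplace QpE_twoScale_empty_eq_zero_iff)
open B5HkOpLandauMin (LapS_towerE)
open B5Eq147Landau (Lap)
open B5Prop11Plancherel (Tor fine)
open B5Block118 (bpt)
open B5Action121 (LapS)
open B5Identities197Torus (RT)
open B15DeterminingSets (embIter)
open N07PointFeasibilityOneLevel (eq_const_of_centres_of_RT_LapS_eq_zero)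

variable {P : Params} {j : ℕ}

/-! ## §1  The record's centres are p16's block points at the middle offset -/

/-- Labels of the iterated centre embedding: `(embIter j y)_μ = y_μ·L^j + (L^j − 1)∕2` (standing range; `Setup.emb` = «label `n ↦ nL + (L−1)∕2`» iterated,
`L` odd). [cite: Balaban1987RG1, (0.1) p.251] -/
theorem val_embIter (hj : j ≤ P.m + P.K) (y : Site P j) (μ : Fin P.d) :
    ((embIter j y) μ).val = (y μ).val * P.L ^ j + (P.L ^ j - 1) / 2 := by
  induction j with
  | zero => simp [embIter]
  | succ j ih =>
    show ((embIter j (emb y)) μ).val = _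
    rw [ih (by omega) (emb y), Site.val_emb (by omega)]
    obtain ⟨r, hr⟩ := P.hL.1
    obtain ⟨t, ht⟩ := P.hL.1.pow (n := j)
    have hLj : P.L ^ (j + 1) = P.L ^ j * P.L := pow_succ _ _
    rw [hLj, ht, hr]
    have e1 : (2 * t + 1) * (2 * r + 1) = 2 * (2 * t * r + t + r) + 1 := by ring
    have e2 : ((y μ).val * (2 * r + 1) + (2 * r + 1 - 1) / 2) * (2 * t + 1)
        = (y μ).val * ((2 * t + 1) * (2 * r + 1)) + (2 * t + 1) * ((2 * r + 1 - 1) / 2) := by ring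
    rw [e2, e1]
    have e3 : (2 * r + 1 - 1) / 2 = r := by omega
    have e4 : (2 * (2 * t * r + t + r) + 1 - 1) / 2 = 2 * t * r + t + r := by omega
    have e5 : (2 * t + 1 - 1) / 2 = t := by omega
    rw [e3, e4, e5]
    ring

/-- `(L^j − 1)∕2 < L^j`. [folklore] -/
theorem half_pow_lt (j : ℕ) : (P.L ^ j - 1) / 2 < P.L ^ j := by
  have := pow_pos P.L_pos j
  omega

/-- ★ **The record's centre is the block point at the middle offset**: `embIter j y = blockSiteK j y c₀`, `c₀ = (L^j − 1)∕2` in every direction.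
[cite: Balaban1987RG1, (0.1) p.251; Balaban1984PropagatorsI, (1.18) p.20] -/
theorem embIter_eq_blockSiteK (hj : j ≤ P.m + P.K) (y : Site P j) :
    embIter j y = blockSiteK j y (fun _ => ⟨(P.L ^ j - 1) / 2, half_pow_lt j⟩) := by
  funext μ
  apply ZMod.val_injective
  rw [val_embIter hj, val_blockSiteK hj]

/-- Hence on p16's one-stroke torus: `EK hj (embIter j y) = bpt (L^j) (Mk P j) y c₀`. [cite: Balaban1984PropagatorsI, (1.18) p.20] -/
theorem EK_embIter (hj : j ≤ P.m + P.K) (y : Site P j) :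
    EK hj (embIter j y) = bpt (P.L ^ j) (Mk P j) y (fun _ => ⟨(P.L ^ j - 1) / 2, half_pow_lt j⟩) := by
  rw [embIter_eq_blockSiteK hj, EK_blockSiteK hj]

/-! ## §2  Transports: values, zero, scalars, and `R∂*∂` -/

/-- Values of the transported function: `f̃ (EK x) = f x` with `f̃ := trS (towerE) (cplxS (tS hj f))`. [cite: Balaban1984PropagatorsI, (1.20) p.20] -/
theorem trS_cplxS_tS_apply (hj : j ≤ P.m + P.K) (g : SiteField P 0 ℝ) (x : Site P 0) :
    trS (towerE P.L (Mk P j) j) (cplxS (tS hj g)) (EK hj x) = ((g x : ℝ) : ℂ) := by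
  have hE : EK hj x = towerE P.L (Mk P j) j (eK hj x) := rfl
  rw [hE, trS_apply]
  simp [cplxS, tS_apply]

/-- The transport of `0` is `0`. [folklore] -/
theorem trS_cplxS_tS_zero (hj : j ≤ P.m + P.K) :
    trS (towerE P.L (Mk P j) j) (cplxS (tS hj (WithLp.ofLp (0 : ScalarSpace P)))) = 0 := by
  funext z
  rw [trS_apply']
  simp [cplxS]

/-- The transport is `ℝ`-linear in the scalar: `(a • l)~ = a • l̃`. [folklore] -/
theorem trS_cplxS_smul (a : ℝ) (l : Scl (towerM P.L (Mk P j) j)) :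
    trS (towerE P.L (Mk P j) j) (cplxS (a • l)) = ((a : ℝ) : ℂ) • trS (towerE P.L (Mk P j) j) (cplxS l) := by
  funext z
  rw [trS_apply', Pi.smul_apply, trS_apply']
  simp [cplxS]

/-- ★ **`R∂*∂f = 0` transports to `RT·(Δf̃) = 0`**: for a one-level `D` (`hD` : `N(Q′_D) = N(Q′_j)`) and `c ≠ 0`, `RE D c (lapE c f) = 0` implies
`RT (L^j) (Mk P j) *ᵥ (LapS (fine (L^j) (Mk P j)) (L^j) *ᵥ f̃) = 0` (`RE_bridge` for `R`, `tS_laplace` + `LapS_towerE` for `Δ`; the lattice factors only rescale).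
[cite: Balaban1984PropagatorsII, (2.10)-(2.12) p.225; Balaban1984PropagatorsI, p.25, (1.69)-(1.70) pp.29-30] -/
theorem RT_LapS_transport_eq_zero (hj : j ≤ P.m + P.K) (D : Domains P)
    (hD : ∀ μ : ScalarSpace P, QpE D μ = 0 ↔ siteAvgIter j (WithLp.ofLp μ) = 0) {c : ℝ} (hc : c ≠ 0) (f : ScalarSpace P)
    (hR : RE D c (lapE c f) = 0) :
    RT (P.L ^ j) (Mk P j) *ᵥ (LapS (fine (P.L ^ j) (Mk P j)) ((P.L ^ j : ℕ) : ℂ) *ᵥ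
      trS (towerE P.L (Mk P j) j) (cplxS (tS hj (WithLp.ofLp f)))) = 0 := by
  have h := RE_bridge hj D hD hc (lapE c f)
  rw [hR, trS_cplxS_tS_zero hj, ofLp_lapE, tS_laplace hj c, trS_cplxS_smul, ← LapS_towerE, Matrix.mulVec_smul] at h
  have hL : ((P.L : ℝ) ^ j) ≠ 0 := pow_ne_zero _ (Nat.cast_ne_zero.mpr P.L_pos.ne')
  have hκ : (((c ^ 2 / ((P.L : ℝ) ^ j) ^ 2 : ℝ)) : ℂ) ≠ 0 := by
    exact_mod_cast div_ne_zero (pow_ne_zero 2 hc) (pow_ne_zero 2 hL)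
  exact (smul_eq_zero.mp h.symm).resolve_left hκ

/-! ## §3  (P) one level on V1 ∕ `Site P 0` -/

/-- ★★★ **LEMMA (P), ONE LEVEL, ON THE RECORD'S CARRIER.**  For every `P : Params` (so `L` odd), `j ≤ m + K`, every one-level domain structure `D`
(`hD` : its site constraints are exactly `Q′_jλ = 0`), every `c ≠ 0` and every `f : ScalarSpace P = ℓ²(T_η)`: if `f` takes the SAME value at every centre
`embIter j y` and `RE D c (lapE c f) = 0` (`R∂*∂f = 0`, [B6] (2.12)), then `f` is constant.  Proof = transport to `Tor (fine (L^j) (Mk P j))` and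
`N07PointFeasibilityOneLevel.eq_const_of_centres_of_RT_LapS_eq_zero` with `n = L^j`, `c₀ = (L^j − 1)∕2`.
[cite: Balaban1984PropagatorsII, (2.10)-(2.12) p.225, (2.22) p.226; Balaban1987RG1, (0.1) p.251, (0.4) p.253] -/
theorem eq_const_of_centres_of_RE_lapE_eq_zero (hj : j ≤ P.m + P.K) (D : Domains P)
    (hD : ∀ μ : ScalarSpace P, QpE D μ = 0 ↔ siteAvgIter j (WithLp.ofLp μ) = 0) {c : ℝ} (hc : c ≠ 0) (f : ScalarSpace P)
    (hctr : ∀ y y' : Site P j, f (embIter j y) = f (embIter j y'))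
    (hR : RE D c (lapE c f) = 0) (x x' : Site P 0) : f x = f x' := by
  haveI : NeZero (P.L ^ j) := ⟨(pow_pos P.L_pos j).ne'⟩
  have hval : ∀ z : Site P 0,
      trS (towerE P.L (Mk P j) j) (cplxS (tS hj (WithLp.ofLp f))) (EK hj z) = ((f z : ℝ) : ℂ) :=
    fun z => trS_cplxS_tS_apply hj (WithLp.ofLp f) z
  have hctrT : ∀ y : Tor (Mk P j),
      trS (towerE P.L (Mk P j) j) (cplxS (tS hj (WithLp.ofLp f)))
          (bpt (P.L ^ j) (Mk P j) y (fun _ => ⟨(P.L ^ j - 1) / 2, half_pow_lt j⟩))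
        = trS (towerE P.L (Mk P j) j) (cplxS (tS hj (WithLp.ofLp f)))
          (bpt (P.L ^ j) (Mk P j) 0 (fun _ => ⟨(P.L ^ j - 1) / 2, half_pow_lt j⟩)) := by
    intro y
    have h0 := EK_embIter hj ((0 : Tor (Mk P j)) : Site P j)
    rw [← EK_embIter hj y, ← h0, hval, hval, hctr y]
  have hRt := RT_LapS_transport_eq_zero hj D hD hc f hR
  have hconst := eq_const_of_centres_of_RT_LapS_eq_zero (P.L ^ j) (Mk P j)
    (fun _ => ⟨(P.L ^ j - 1) / 2, half_pow_lt j⟩) (fun _ => T4UndoubledRP.two_mul_half_pow_add_one (P := P) j) _ hctrT hRt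
  have e1 := hval x
  have e2 := hval x'
  rw [hconst (EK hj x)] at e1
  rw [hconst (EK hj x')] at e2
  exact_mod_cast e1.symm.trans e2

/-- ★★★ **… hence a trivial pure gauge: `dE c f = 0`** — the conclusion of the `hker` letter `∀ μ, ∂_c(Eμ) = 0 → R∂*∂μ = 0 → ∂μ = 0` of
`N07FlatHFeasibility.exists_admissible_grad_of_flatKernel` with `E` = evaluation at the centres, at ONE level, on V1's carriers.
[cite: Balaban1984PropagatorsII, (2.22) p.226, (2.35) p.228; Balaban1987RG1, (0.4) p.253] -/
theorem dE_eq_zero_of_centres_of_RE_lapE_eq_zero (hj : j ≤ P.m + P.K) (D : Domains P)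
    (hD : ∀ μ : ScalarSpace P, QpE D μ = 0 ↔ siteAvgIter j (WithLp.ofLp μ) = 0) {c : ℝ} (hc : c ≠ 0) (f : ScalarSpace P)
    (hctr : ∀ y y' : Site P j, f (embIter j y) = f (embIter j y'))
    (hR : RE D c (lapE c f) = 0) : dE c f = 0 := by
  have h := eq_const_of_centres_of_RE_lapE_eq_zero hj D hD hc f hctr hR
  have h0 : WithLp.ofLp (dE c f) = 0 := by
    rw [ofLp_dE]
    funext b
    simp [grad, h b.tgt b.src]
  have h1 : dE c f = WithLp.toLp 2 (WithLp.ofLp (dE c f)) := rfl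
  rw [h1, h0]
  rfl

/-- The one-level member of [B6] Sect. C (p22's `twoScale j hj ∅`, all lower domains `= T_η`): centres-constant ∧ `RE (twoScale j hj ∅) c (lapE c f) = 0` ⇒ `f` constant.
[cite: Balaban1984PropagatorsII, (2.12) p.225, (2.90) p.239] -/
theorem eq_const_of_centres_of_RE_lapE_eq_zero_twoScale_empty (hj : j + 1 ≤ P.m + P.K) {c : ℝ} (hc : c ≠ 0) (f : ScalarSpace P)
    (hctr : ∀ y y' : Site P j, f (embIter j y) = f (embIter j y'))
    (hR : RE (twoScale j hj ∅) c (lapE c f) = 0) (x x' : Site P 0) : f x = f x' :=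
  eq_const_of_centres_of_RE_lapE_eq_zero (Nat.le_of_succ_le hj) (twoScale j hj ∅) (QpE_twoScale_empty_eq_zero_iff hj) hc f hctr hR x x'

/-- … and `dE c f = 0` there. [cite: Balaban1984PropagatorsII, (2.12) p.225, (2.22) p.226] -/
theorem dE_eq_zero_of_centres_of_RE_lapE_eq_zero_twoScale_empty (hj : j + 1 ≤ P.m + P.K) {c : ℝ} (hc : c ≠ 0) (f : ScalarSpace P)
    (hctr : ∀ y y' : Site P j, f (embIter j y) = f (embIter j y'))
    (hR : RE (twoScale j hj ∅) c (lapE c f) = 0) : dE c f = 0 :=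
  dE_eq_zero_of_centres_of_RE_lapE_eq_zero (Nat.le_of_succ_le hj) (twoScale j hj ∅) (QpE_twoScale_empty_eq_zero_iff hj) hc f hctr hR

end Summit.QuantumFields.YangMills.BalabanUVNodes.N07PointFeasibilityOneLevelV1

end
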